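import Summits.Ventures.DiscreteObjects.Hadamard.Order4NegaCore
import Summits.Ventures.DiscreteObjects.Hadamard.SqrtThreeNorm4q

/-!
# H(4q), q ≡ 11 (mod 12): an order-6 automorphism with fixed-point-free cube has an EVEN number of 6-cycles — core case

Framing: lottery ticket; floor = certified bounds/negative ranges.

Cell pub-namedobj (venture DiscreteObjects), target (H), hadamard gen 14; HANDOFF-H-g13 open item 3 (the `√3`-folding).
If `g = (π, κ, d, e)` is a signed automorphism of a Hadamard matrix of order `4q` (`q ≡ 11 (mod 12)` prime: `668 = 4·167`,
`716 = 4·179`) with `π⁶ = κ⁶ = 1` and `π³, κ³` fixed-point-free, then `g³` is a NEGA involution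
(`fpf_involution_nega_general`), so `π` is a product of `a` nega `6`-cycles and `b` nega `2`-cycles (`6a + 2b = 4q`).
Conjugating by signed permutations brings `g` to the BLOCK NORMAL FORM treated here: index set `(Fin 6 × A) ⊕ (Fin 2 × B)`,
`π = κ = σ` the shift `p ↦ p + 1` on both summands, signs `d = e = d₀` with `d₀ = −1` exactly on `p = 5` (first summand) and
`p = 1` (second summand), so that the signed permutation matrix `P` satisfies `P⁶ = −I` on the `6`-blocks and `P² = −I` on
the `2`-blocks.

**`no_hadamard4q_nega6_blockform`**: if `|A|` is ODD, no Hadamard matrix on `(Fin 6 × A) ⊕ (Fin 2 × B)` of order `4q`,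
`q ≡ 11 (mod 12)` prime, has the signed automorphism `(σ, σ, d₀, d₀)`.  PROOF (the `√3`-folding): over `F = ℚ(√3)`
(`QuadraticAlgebra ℚ 3 0`, `r = ω`, `r² = 3`) let `S = P + Pᵀ`; on a nega `6`-block `S₆ = N₆ + N₆ᵀ` has eigenvalues
`0, ±√3` (`S₆³ = 3 S₆`) and the rows of `U₀ = [[2, r, 1, 0, −1, −r], [0, 1, r, 2, r, 1]]` are an orthogonal basis of its
`√3`-eigenspace (`U₀ U₀ᵀ = 12·1`, `U₀ᵀ U₀ = 2 S₆² + 2r S₆`); on a nega `2`-block `S = 0`.  With `U = (diag(U₀, …, U₀) | 0)` and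
`R = 2S² + 2rS`: `Uᵀ U = R`, `H R Hᵀ = 4q·R` (`P H = H P`, `Pᵀ H = H Pᵀ`), `U R Uᵀ = 144·1`, so `folding_two_squares_field`
(on `|Fin 2 × A| = 2|A| ≡ 2 (mod 4)` coordinates) gives `4q = u² + v²` in `ℚ(√3)`, contradicting
`not_sum_two_sq_4q_sqrtThree`.  The transfer from an arbitrary `(π, κ, d, e)` to the normal form is `Order6Nega`.
Ours; no `sorry`.
-/

namespace Summit.Ventures.DiscreteObjects.Hadamard

open Finset BigOperators Matrix QuadraticAlgebra

open Literature.Combinatorics.Designs.GoethalsSeidel (IsHadamardMatrix)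

section core6
variable {A B : Type*} [Fintype A] [DecidableEq A] [Fintype B] [DecidableEq B]

omit [DecidableEq B] in
/-- block algebra: a polynomial `c S² + d S` of `S = diag(S₆, …, S₆) ⊕ 0` is `diag(c S₆² + d S₆, …) ⊕ 0` -/
lemma negaSix_blocks_poly {F : Type*} [CommRing F] (S₆ : Matrix (Fin 6) (Fin 6) F) (c d : F)
    (S : Matrix ((Fin 6 × A) ⊕ (Fin 2 × B)) ((Fin 6 × A) ⊕ (Fin 2 × B)) F)
    (hS : S = Matrix.fromBlocks (blockDiagonal (fun _ : A => S₆)) 0 0 0) :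
    c • (S * S) + d • S = Matrix.fromBlocks (blockDiagonal (fun _ : A => c • (S₆ * S₆) + d • S₆)) 0 0 0 := by
  have hSS : S * S = Matrix.fromBlocks (blockDiagonal (fun _ : A => S₆ * S₆)) 0 0 0 := by
    rw [hS, fromBlocks_multiply]
    simp only [Matrix.mul_zero, Matrix.zero_mul, add_zero]
    rw [← blockDiagonal_mul]
  rw [hSS, hS, fromBlocks_smul, fromBlocks_smul, fromBlocks_add]
  simp only [smul_zero, add_zero]
  rw [← blockDiagonal_smul, ← blockDiagonal_smul, ← blockDiagonal_add]
  rfl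

omit [Fintype A] [Fintype B] in
/-- block algebra: `P + Pᵀ` for `P = diag(N₆, …) ⊕ diag(N₂, …)` with `N₂ + N₂ᵀ = 0` -/
lemma negaSix_blocks_transpose_add {F : Type*} [CommRing F] (N₆ : Matrix (Fin 6) (Fin 6) F)
    (N₂ : Matrix (Fin 2) (Fin 2) F) (hN2 : N₂ + N₂ᵀ = 0)
    (P : Matrix ((Fin 6 × A) ⊕ (Fin 2 × B)) ((Fin 6 × A) ⊕ (Fin 2 × B)) F)
    (hP : P = Matrix.fromBlocks (blockDiagonal (fun _ : A => N₆)) 0 0 (blockDiagonal (fun _ : B => N₂))) :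
    P + Pᵀ = Matrix.fromBlocks (blockDiagonal (fun _ : A => N₆ + N₆ᵀ)) 0 0 0 := by
  rw [hP, fromBlocks_transpose, fromBlocks_add, transpose_zero, transpose_zero, add_zero, add_zero,
    blockDiagonal_transpose, blockDiagonal_transpose, ← blockDiagonal_add, ← blockDiagonal_add]
  have e1 : ((fun _ : A => N₆) + fun _ : A => N₆ᵀ) = fun _ : A => N₆ + N₆ᵀ := by
    funext a; rfl
  have e2 : ((fun _ : B => N₂) + fun _ : B => N₂ᵀ) = 0 := by
    funext b; show N₂ + N₂ᵀ = 0; exact hN2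
  rw [e1, e2, blockDiagonal_zero]

omit [DecidableEq B] in
/-- block algebra: the Gram matrices of the folding matrix `U = (diag(U₀, …) | 0)` -/
lemma negaSix_blocks_fold {F : Type*} [CommRing F] (U₀ : Matrix (Fin 2) (Fin 6) F)
    (R₀ : Matrix (Fin 6) (Fin 6) F) (s : F) (hA2 : U₀ᵀ * U₀ = R₀) (hA1 : U₀ * U₀ᵀ = s • 1)
    (U : Matrix (Fin 2 × A) ((Fin 6 × A) ⊕ (Fin 2 × B)) F) (hU : U = Matrix.fromCols (blockDiagonal (fun _ : A => U₀)) 0) :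
    Uᵀ * U = Matrix.fromBlocks (blockDiagonal (fun _ : A => R₀)) 0 0 0 ∧ U * Uᵀ = s • 1 := by
  constructor
  · rw [hU, transpose_fromCols, fromRows_mul_fromCols, transpose_zero, Matrix.mul_zero, Matrix.zero_mul,
      Matrix.zero_mul, blockDiagonal_transpose, ← blockDiagonal_mul]
    rw [show (fun _ : A => U₀ᵀ * U₀) = fun _ => R₀ from funext fun _ => hA2]
  · rw [hU, transpose_fromCols, fromCols_mul_fromRows, transpose_zero, Matrix.mul_zero, add_zero,
      blockDiagonal_transpose, ← blockDiagonal_mul]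
    have e1 : (fun _ : A => U₀ * U₀ᵀ) = s • (1 : A → Matrix (Fin 2) (Fin 2) F) := by
      funext c; rw [hA1]; rfl
    rw [e1, blockDiagonal_smul, blockDiagonal_one]

omit [Fintype A] [DecidableEq A] [Fintype B] [DecidableEq B] in
/-- a matrix commuting with `S` commutes with `a S² + b S` -/
lemma comm_smul_sq_add_smul {F : Type*} [CommRing F] {ι : Type*} [Fintype ι] (a b : F)
    (Hq S : Matrix ι ι F) (hHS : Hq * S = S * Hq) :
    Hq * (a • (S * S) + b • S) = (a • (S * S) + b • S) * Hq := by
  have hHSS : Hq * (S * S) = S * S * Hq := by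
    rw [← Matrix.mul_assoc, hHS, Matrix.mul_assoc, hHS, Matrix.mul_assoc]
  simp only [Matrix.mul_add, Matrix.add_mul, Matrix.mul_smul, Matrix.smul_mul, hHSS, hHS]

/-- the nega `6`-cycle block plus its transpose is the explicit symmetric `0/±1` matrix `S₆` -/
lemma nega6_add_transpose {F : Type*} [Ring F] (N₆ : Matrix (Fin 6) (Fin 6) F)
    (hN : N₆ = fun k i => if k = i + 1 then (if i = 5 then -1 else 1) else 0) :
    N₆ + N₆ᵀ =
      !![0, 1, 0, 0, 0, -1; 1, 0, 1, 0, 0, 0; 0, 1, 0, 1, 0, 0; 0, 0, 1, 0, 1, 0; 0, 0, 0, 1, 0, 1; -1, 0, 0, 0, 1, 0] := by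
  ext i j : 1
  fin_cases i <;> fin_cases j <;> simp [hN, Matrix.add_apply]

/-- the nega `2`-cycle block plus its transpose vanishes -/
lemma nega2_add_transpose {F : Type*} [Ring F] (N₂ : Matrix (Fin 2) (Fin 2) F)
    (hN : N₂ = fun k i => if k = i + 1 then (if i = 1 then -1 else 1) else 0) : N₂ + N₂ᵀ = 0 := by
  ext i j : 1
  fin_cases i <;> fin_cases j <;> simp [hN, Matrix.add_apply]

/-- the square of `S₆` -/
lemma sym6_mul_self {F : Type*} [CommRing F] :
    (!![0, 1, 0, 0, 0, -1; 1, 0, 1, 0, 0, 0; 0, 1, 0, 1, 0, 0; 0, 0, 1, 0, 1, 0; 0, 0, 0, 1, 0, 1; -1, 0, 0, 0, 1, 0] :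
        Matrix (Fin 6) (Fin 6) F) *
      !![0, 1, 0, 0, 0, -1; 1, 0, 1, 0, 0, 0; 0, 1, 0, 1, 0, 0; 0, 0, 1, 0, 1, 0; 0, 0, 0, 1, 0, 1; -1, 0, 0, 0, 1, 0] =
      !![2, 0, 1, 0, -1, 0; 0, 2, 0, 1, 0, -1; 1, 0, 2, 0, 1, 0; 0, 1, 0, 2, 0, 1; -1, 0, 1, 0, 2, 0; 0, -1, 0, 1, 0, 2] := by
  ext i j : 1
  fin_cases i <;> fin_cases j <;> simp [Matrix.mul_apply, Fin.sum_univ_six] <;> norm_num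

/-- the folding rows `U₀` (a basis of the `√3`-eigenspace of `S₆` over `ℚ(√3)`): `U₀ U₀ᵀ = 12·1` -/
lemma fold6_mul_transpose :
    (!![2, ω, 1, 0, -1, -ω; 0, 1, ω, 2, ω, 1] : Matrix (Fin 2) (Fin 6) (QuadraticAlgebra ℚ 3 0)) *
      (!![2, ω, 1, 0, -1, -ω; 0, 1, ω, 2, ω, 1] : Matrix (Fin 2) (Fin 6) (QuadraticAlgebra ℚ 3 0))ᵀ =
      (12 : QuadraticAlgebra ℚ 3 0) • (1 : Matrix (Fin 2) (Fin 2) (QuadraticAlgebra ℚ 3 0)) := by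
  ext i j <;> fin_cases i <;> fin_cases j <;> simp [Matrix.mul_apply, Fin.sum_univ_six] <;> norm_num

/-- the folding rows `U₀`: `U₀ᵀ U₀ = 2 S₆² + 2ω S₆` -/
lemma fold6_transpose_mul :
    (!![2, ω, 1, 0, -1, -ω; 0, 1, ω, 2, ω, 1] : Matrix (Fin 2) (Fin 6) (QuadraticAlgebra ℚ 3 0))ᵀ *
      (!![2, ω, 1, 0, -1, -ω; 0, 1, ω, 2, ω, 1] : Matrix (Fin 2) (Fin 6) (QuadraticAlgebra ℚ 3 0)) =
      (2 : QuadraticAlgebra ℚ 3 0) •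
        (!![2, 0, 1, 0, -1, 0; 0, 2, 0, 1, 0, -1; 1, 0, 2, 0, 1, 0; 0, 1, 0, 2, 0, 1; -1, 0, 1, 0, 2, 0; 0, -1, 0, 1, 0, 2] :
          Matrix (Fin 6) (Fin 6) (QuadraticAlgebra ℚ 3 0)) +
      ((2 : QuadraticAlgebra ℚ 3 0) * ω) •
        (!![0, 1, 0, 0, 0, -1; 1, 0, 1, 0, 0, 0; 0, 1, 0, 1, 0, 0; 0, 0, 1, 0, 1, 0; 0, 0, 0, 1, 0, 1; -1, 0, 0, 0, 1, 0] :
          Matrix (Fin 6) (Fin 6) (QuadraticAlgebra ℚ 3 0)) := by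
  ext i j <;> fin_cases i <;> fin_cases j <;>
    simp [Matrix.mul_apply, Fin.sum_univ_two, Matrix.add_apply] <;> norm_num

/-- Gram identity: `U Uᵀ = s·1` implies `U (Uᵀ U) Uᵀ = s²·1` -/
lemma gram_fold_sq {F : Type*} [CommRing F] {α ι : Type*} [Fintype α] [Fintype ι] [DecidableEq α]
    (U : Matrix α ι F) (s : F) (hUU : U * Uᵀ = s • (1 : Matrix α α F)) :
    U * (Uᵀ * U) * Uᵀ = (s ^ 2) • (1 : Matrix α α F) := by
  calc U * (Uᵀ * U) * Uᵀ = (U * Uᵀ) * (U * Uᵀ) := by simp only [Matrix.mul_assoc]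
    _ = (s ^ 2) • (1 : Matrix α α F) := by rw [hUU, Matrix.smul_mul, Matrix.one_mul, smul_smul, pow_two]

/-- **No H(4q), `q ≡ 11 (mod 12)` prime, in block normal form with the standard nega order-6 symmetry and an ODD number of
6-cycles.**  On `(Fin 6 × A) ⊕ (Fin 2 × B)` with `|A|` odd and total cardinality `4q`, no Hadamard matrix admits the signed
automorphism `(σ, σ, d₀, d₀)` with `σ = (p, c) ↦ (p + 1, c)` on both summands and `d₀ = −1` exactly at `p = 5` on the
`6`-cycles and at `p = 1` on the `2`-cycles. -/
theorem no_hadamard4q_nega6_blockform {q : ℕ} (hq : q.Prime) (hq12 : q % 12 = 11)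
    (hcard : Fintype.card ((Fin 6 × A) ⊕ (Fin 2 × B)) = 4 * q) (hA : Odd (Fintype.card A))
    (H : Matrix ((Fin 6 × A) ⊕ (Fin 2 × B)) ((Fin 6 × A) ⊕ (Fin 2 × B)) ℤ) (hH : IsHadamardMatrix H)
    (haut : IsSignedAut H
      (Equiv.sumCongr ((finRotate 6).prodCongr (Equiv.refl A)) ((finRotate 2).prodCongr (Equiv.refl B)))
      (Equiv.sumCongr ((finRotate 6).prodCongr (Equiv.refl A)) ((finRotate 2).prodCongr (Equiv.refl B)))
      (Sum.elim (fun x => if x.1 = 5 then -1 else 1) (fun x => if x.1 = 1 then -1 else 1))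
      (Sum.elim (fun x => if x.1 = 5 then -1 else 1) (fun x => if x.1 = 1 then -1 else 1))) : False := by
  haveI := sqrtThree_field_fact
  -- the field ℚ(√3) and r = √3
  set r : QuadraticAlgebra ℚ 3 0 := ω with hrdef
  set σ : Equiv.Perm ((Fin 6 × A) ⊕ (Fin 2 × B)) :=
    Equiv.sumCongr ((finRotate 6).prodCongr (Equiv.refl A)) ((finRotate 2).prodCongr (Equiv.refl B)) with hσdef
  set d₀ : (Fin 6 × A) ⊕ (Fin 2 × B) → ℤ :=
    Sum.elim (fun x => if x.1 = 5 then -1 else 1) (fun x => if x.1 = 1 then -1 else 1) with hd₀def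
  have hσl : ∀ (p : Fin 6) (a : A), σ (Sum.inl (p, a)) = Sum.inl (p + 1, a) := by
    intro p a; simp [hσdef]
  have hσr : ∀ (p : Fin 2) (b : B), σ (Sum.inr (p, b)) = Sum.inr (p + 1, b) := by
    intro p b; simp [hσdef]
  have hd₀l : ∀ (p : Fin 6) (a : A), d₀ (Sum.inl (p, a)) = if p = 5 then -1 else 1 := fun _ _ => rfl
  have hd₀r : ∀ (p : Fin 2) (b : B), d₀ (Sum.inr (p, b)) = if p = 1 then -1 else 1 := fun _ _ => rfl
  -- cardinalities
  have hα : Fintype.card (Fin 2 × A) % 4 = 2 := by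
    obtain ⟨k, hk⟩ := hA
    rw [Fintype.card_prod, Fintype.card_fin, hk]; omega
  -- H over F
  set Hq : Matrix ((Fin 6 × A) ⊕ (Fin 2 × B)) ((Fin 6 × A) ⊕ (Fin 2 × B)) (QuadraticAlgebra ℚ 3 0) :=
    H.map (Int.castRingHom _) with hHqdef
  have hHq : Hq * Hqᵀ = ((4 * q : ℕ) : QuadraticAlgebra ℚ 3 0) • (1 : Matrix _ _ _) := by
    have h1 : Hq * Hqᵀ = (H * Hᵀ).map (Int.castRingHom _) := by
      rw [Matrix.map_mul, hHqdef, transpose_map]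
    rw [h1, hH.2, hcard]
    ext i j : 1
    rw [Matrix.map_apply, Matrix.smul_apply, Matrix.smul_apply, Matrix.one_apply, Matrix.one_apply]
    split_ifs <;> simp
  -- the blocks
  set N₆ : Matrix (Fin 6) (Fin 6) (QuadraticAlgebra ℚ 3 0) :=
    fun k i => if k = i + 1 then (if i = 5 then -1 else 1) else 0 with hN₆def
  set N₂ : Matrix (Fin 2) (Fin 2) (QuadraticAlgebra ℚ 3 0) :=
    fun k i => if k = i + 1 then (if i = 1 then -1 else 1) else 0 with hN₂def
  set S₆ : Matrix (Fin 6) (Fin 6) (QuadraticAlgebra ℚ 3 0) := N₆ + N₆ᵀ with hS₆def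
  set U₀ : Matrix (Fin 2) (Fin 6) (QuadraticAlgebra ℚ 3 0) :=
    !![2, r, 1, 0, -1, -r; 0, 1, r, 2, r, 1] with hU₀def
  -- the explicit symmetric block `S₆ = N₆ + N₆ᵀ` and its square
  set S₆L : Matrix (Fin 6) (Fin 6) (QuadraticAlgebra ℚ 3 0) :=
    !![0, 1, 0, 0, 0, -1; 1, 0, 1, 0, 0, 0; 0, 1, 0, 1, 0, 0; 0, 0, 1, 0, 1, 0; 0, 0, 0, 1, 0, 1; -1, 0, 0, 0, 1, 0]
    with hS₆Ldef
  set T₆L : Matrix (Fin 6) (Fin 6) (QuadraticAlgebra ℚ 3 0) :=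
    !![2, 0, 1, 0, -1, 0; 0, 2, 0, 1, 0, -1; 1, 0, 2, 0, 1, 0; 0, 1, 0, 2, 0, 1; -1, 0, 1, 0, 2, 0; 0, -1, 0, 1, 0, 2]
    with hT₆Ldef
  have hS₆L : S₆ = S₆L := by
    rw [hS₆def, hS₆Ldef]; exact nega6_add_transpose N₆ hN₆def
  have hT₆L : S₆L * S₆L = T₆L := by
    rw [hS₆Ldef, hT₆Ldef]; exact sym6_mul_self
  have hA1 : U₀ * U₀ᵀ = (12 : QuadraticAlgebra ℚ 3 0) • (1 : Matrix (Fin 2) (Fin 2) _) := by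
    rw [hU₀def, hrdef]; exact fold6_mul_transpose
  have hA2 : U₀ᵀ * U₀ = (2 : QuadraticAlgebra ℚ 3 0) • (S₆ * S₆) + ((2 : QuadraticAlgebra ℚ 3 0) * r) • S₆ := by
    rw [hS₆L, hT₆L, hU₀def, hS₆Ldef, hT₆Ldef, hrdef]; exact fold6_transpose_mul
  have hN2 : N₂ + N₂ᵀ = 0 := nega2_add_transpose N₂ hN₂def
  -- the global signed permutation matrix
  set P : Matrix ((Fin 6 × A) ⊕ (Fin 2 × B)) ((Fin 6 × A) ⊕ (Fin 2 × B)) (QuadraticAlgebra ℚ 3 0) :=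
    Matrix.fromBlocks (blockDiagonal (fun _ : A => N₆)) 0 0 (blockDiagonal (fun _ : B => N₂)) with hPdef
  have hPspec : ∀ k i, P k i = if k = σ i then (d₀ i : QuadraticAlgebra ℚ 3 0) else 0 := by
    rintro (⟨k, a⟩ | ⟨k, b⟩) (⟨i, a'⟩ | ⟨i, b'⟩)
    · rw [hPdef, fromBlocks_apply₁₁, hσl, hd₀l]
      by_cases ha : a = a'
      · subst ha
        rw [blockDiagonal_apply_eq]
        have e1 : (Sum.inl (k, a) = (Sum.inl (i + 1, a) : (Fin 6 × A) ⊕ (Fin 2 × B))) ↔ k = i + 1 := by simp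
        simp only [hN₆def, e1]
        split_ifs <;> simp
      · rw [blockDiagonal_apply_ne _ _ _ ha]
        have e1 : ¬ (Sum.inl (k, a) = (Sum.inl (i + 1, a') : (Fin 6 × A) ⊕ (Fin 2 × B))) := by
          simp [ha]
        rw [if_neg e1]
    · rw [hPdef, fromBlocks_apply₁₂, hσr, Matrix.zero_apply]
      rw [if_neg (by simp)]
    · rw [hPdef, fromBlocks_apply₂₁, hσl, Matrix.zero_apply]
      rw [if_neg (by simp)]
    · rw [hPdef, fromBlocks_apply₂₂, hσr, hd₀r]
      by_cases hb : b = b'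
      · subst hb
        rw [blockDiagonal_apply_eq]
        have e1 : (Sum.inr (k, b) = (Sum.inr (i + 1, b) : (Fin 6 × A) ⊕ (Fin 2 × B))) ↔ k = i + 1 := by simp
        simp only [hN₂def, e1]
        split_ifs <;> simp
      · rw [blockDiagonal_apply_ne _ _ _ hb]
        have e1 : ¬ (Sum.inr (k, b) = (Sum.inr (i + 1, b') : (Fin 6 × A) ⊕ (Fin 2 × B))) := by
          simp [hb]
        rw [if_neg e1]
  have hPH : P * Hq = Hq * P := sgnPerm_intertwine_gen haut P P hPspec hPspec
  have hPtH : Pᵀ * Hq = Hq * Pᵀ := sgnPerm_transpose_intertwine_gen haut P P hPspec hPspec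
  -- S = P + Pᵀ and the Gram matrix Rm = 2 S² + 2 r S, in block form
  -- (`obtain` rather than `set`: keeps the big block terms out of definitional unfolding)
  obtain ⟨S, hSdef⟩ : ∃ S : Matrix ((Fin 6 × A) ⊕ (Fin 2 × B)) ((Fin 6 × A) ⊕ (Fin 2 × B)) (QuadraticAlgebra ℚ 3 0),
      S = Matrix.fromBlocks (blockDiagonal (fun _ : A => S₆)) 0 0 0 := ⟨_, rfl⟩
  have hS : P + Pᵀ = S := by
    rw [hSdef, hS₆def]
    exact negaSix_blocks_transpose_add N₆ N₂ hN2 P hPdef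
  obtain ⟨Rm, hRmdef⟩ : ∃ Rm : Matrix ((Fin 6 × A) ⊕ (Fin 2 × B)) ((Fin 6 × A) ⊕ (Fin 2 × B)) (QuadraticAlgebra ℚ 3 0),
      Rm = Matrix.fromBlocks (blockDiagonal (fun _ : A =>
        (2 : QuadraticAlgebra ℚ 3 0) • (S₆ * S₆) + ((2 : QuadraticAlgebra ℚ 3 0) * r) • S₆)) 0 0 0 := ⟨_, rfl⟩
  have hRm : (2 : QuadraticAlgebra ℚ 3 0) • (S * S) + ((2 : QuadraticAlgebra ℚ 3 0) * r) • S = Rm := by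
    rw [hRmdef]
    exact negaSix_blocks_poly S₆ _ _ S hSdef
  -- the folding matrix U
  obtain ⟨U, hUdef⟩ : ∃ U : Matrix (Fin 2 × A) ((Fin 6 × A) ⊕ (Fin 2 × B)) (QuadraticAlgebra ℚ 3 0),
      U = Matrix.fromCols (blockDiagonal (fun _ : A => U₀)) 0 := ⟨_, rfl⟩
  have hfold := negaSix_blocks_fold U₀ _ (12 : QuadraticAlgebra ℚ 3 0) hA2 hA1 U hUdef
  have hV : Uᵀ * U = Rm := by
    rw [hRmdef]; exact hfold.1
  have hUU : U * Uᵀ = (12 : QuadraticAlgebra ℚ 3 0) • (1 : Matrix (Fin 2 × A) (Fin 2 × A) (QuadraticAlgebra ℚ 3 0)) :=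
    hfold.2
  -- forget the block structure: only the algebraic identities are used from here on
  clear hfold hUdef hRmdef hSdef hPdef hPspec hA2 hA1 hS₆L hT₆L hN2 hU₀def hS₆Ldef hT₆Ldef hS₆def hN₆def hN₂def
    hσl hσr hd₀l hd₀r
  clear_value P Hq r
  clear U₀ S₆L T₆L S₆ N₆ N₂
  have hHS : Hq * S = S * Hq := by
    rw [← hS, Matrix.mul_add, Matrix.add_mul, ← hPH, ← hPtH]
  have hHR : Hq * Rm * Hqᵀ = ((4 * q : ℕ) : QuadraticAlgebra ℚ 3 0) • Rm := by
    have h2 : Hq * Rm = Rm * Hq := by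
      rw [← hRm]
      exact comm_smul_sq_add_smul _ _ Hq S hHS
    rw [h2, Matrix.mul_assoc, hHq, Matrix.mul_smul, Matrix.mul_one]
  have hU : U * Rm * Uᵀ = ((12 : QuadraticAlgebra ℚ 3 0) ^ 2) •
      (1 : Matrix (Fin 2 × A) (Fin 2 × A) (QuadraticAlgebra ℚ 3 0)) := by
    rw [← hV]
    exact gram_fold_sq U _ hUU
  have h12 : (12 : QuadraticAlgebra ℚ 3 0) ≠ 0 := by
    intro h; have := congrArg QuadraticAlgebra.re h; simp at this
  obtain ⟨u, v, huv⟩ := folding_two_squares_field Hq Rm Rm U U (4 * q) (12 : QuadraticAlgebra ℚ 3 0) h12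
    hV hHR hU (Equiv.refl _) hα
  have hcast : ((4 * q : ℕ) : QuadraticAlgebra ℚ 3 0) = 4 * (q : QuadraticAlgebra ℚ 3 0) := by
    rw [Nat.cast_mul, Nat.cast_ofNat]
  exact not_sum_two_sq_4q_sqrtThree hq hq12 ⟨u, v, by rw [huv, hcast]⟩

end core6

end Summit.Ventures.DiscreteObjects.Hadamard
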